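import Summits.BirchSwinnertonDyer.BirchSwinnertonDyer.Theses.UniversalToricDescent
import Summits.BirchSwinnertonDyer.BirchSwinnertonDyer.Theorems.EisensteinPrimesHidaLimitFittingBoundConverse
import Summits.BirchSwinnertonDyer.Rank1Residual.X11b.BDPRouteOpenInputDegenerateFrame
import Summits.BirchSwinnertonDyer.Rank1Residual.Additive.WildThreeKrausCells
import Literature.NumberTheory.EllipticCurves.UnrIntegersUnits
import Mathlib.Analysis.Normed.Group.Ultra
import Mathlib.Topology.Algebra.InfiniteSum.NatInt
import HarnessLib

/-!
# NODE (D-0171) on crux stmt-BirchSwinnertonDyer-24207 `UniversalToricDescent.RationalSplitIMCInclusionAtThree`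
# — idea `cubic-taming-descent` (crux-ideate seat `cruxidea-stmt-BirchSwinnertonDyer-24207-1` gen 11, 2026-08-31)

KIND: crux-ideation node (no route, no new items). The crux (RATWALL: Kato-direction rational anticyclotomic IMC
inclusion `∃ k, 3ᵏ·L_BDP ∈ Ch_Λ(X_(∅,0))·R₀⟦T⟧` for WILD additive `p = 3`, class O6, `3` split in `K`) is FIXED; this
file only composes TOWARD it BY NAME and tags every piece.  «beyond-print theorem»: no.  BSD is proved for no curve here.

## g11 verdicts on the live ideas (KEEP/KILL; evidence in the seat's HANDOFF-cruxidea-24207-1-g11.md)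
* `torsion-anchored-reciprocity` (g10, A ∧ T): KEEP — T attackable (M); A's producer (R3) had NO candidate supply.  This node
  records the one place a candidate supply exists (Kraus `Φ = C₃` rows, over a cubic field) and what it costs (an EXCESS FACTOR).
* `eisenstein-kato-swap` (g0): KEEP as sibling input — its Eisenstein inclusion P1 is USED below (integrality of the excess).
* KILLED this gen (evidence): KLZ anchor-free reciprocity K-g10-1 (outcome B: [KLZ17 arXiv:1503.02888 p.10–12, Rem. 10.2.3]);
  weight-(2,1) Beilinson–Flach exp* L-g10-2 (negative); even-degree / Galois base change as a global move (parity lock, B-g11-1);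
  ordinary congruence partners mod 3ⁿ (B-g11-2); «excess factor is a unit» (B-g64-1, utd-idea g64 — CONFIRMED and made
  unconditional in B-g11-6 below).  Earlier kills stand (universal-toric-half-order, germ-recentred-tempered-heegner).
* LEAD lines (fern-reciprocity K1, stable-fibre-regulator K2(b-val)): UNDECIDED, untouched.  L-g10-1 parked on acq-14979.

## The lever: ODD-DEGREE NON-GALOIS TAMING + DESCENT WITH COPRIME EXCESS (lineage: g50 D-g50-1(ii)/B-g50-5, g63 L7 «Kida /
crystallising cubic base change — not class-wide, dead», g64 lever B «twisted BDP values are units» → B-g64-1, found-nothing).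
What gen 11 adds: (a) the ROW THEOREM (which Kraus classes admit an odd-degree taming with an indefinite Heegner supply —
exactly `Φ = C₃`, with the Mackey/CFT proof, correcting barrier B-g7-3); (b) the CORRECT residual after B-g64-1 — 3-power BÉZOUT
COPRIMALITY of the excess factor with `Ch(X_K)`, typed, with the kernel composition to the crux; (c) B-g11-6: every taming base
field has `3 ∣ [F:ℚ]`, so the excess Artin motive ALWAYS meets the principal 3-block and unit-ness of the excess is impossible off
the `λ(L_E) = 0` (Nakayama-anchor) locus — the residual is genuine ZERO-AVOIDANCE; (d) the observation that over `KL` every prime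
above 3 is GOOD supersingular for `E_L`, so the Kolyvagin-system machine upstairs is print-adjacent except for the ramified base.

ROW THEOREM (informal; tree `krausInertiaOrderThree`).  Inside class O6, `Φ = C₃` iff `v₃(Δ_min) ≡ 0 (mod 4)` (Kodaira II/II*,
`v₃(N) = 4`; predicate `TamableByCubic`).  For a supercuspidal-unramified such row `V|_{G_ℚ₃} = Ind_{ℚ₉} ψ`, `ψ|_{𝒪₉^×}` of order 3;
let `L_w/ℚ₃` be the NON-GALOIS totally ramified cubic cut out by local CFT from `χ : ℚ₉^× → C₃`, `χ|_{𝒪₉^×} = ψ|_{𝒪₉^×}`,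
`χ(3) = 1` (`S₃`-closure `Ñ = L_w·ℚ₉`).  Mackey (one double coset, coprime degrees): `V|_{G_{L_w}} = Ind_{W_Ñ}^{W_{L_w}}(ψ|_{W_Ñ})`, and
`ψ|_{W_Ñ}` is UNRAMIFIED since `N_{Ñ/ℚ₉}(𝒪_Ñ^×) = ker ψ|_{𝒪₉^×}`.  So for ANY totally real cubic `L` with `L ⊗ ℚ₃ ≅ L_w`: `E/L` is GOOD
supersingular at the unique `w ∣ 3` (`j(Ẽ) = 0`), `[L:ℚ] = 3` odd ⇒ `ε(E_L/KL) = -1`, CM points on an INDEFINITE quaternionic Shimura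
curve over `L`, `w` split in `KL`, Heegner tower of `w`-power conductor with the supersingular three-term relation — NOT trace-zero
(principal-series `C₃` rows: `L_w = ℚ₃(ζ₉)⁺`).  On `C₆` rows cubic taming leaves `Φ_L = {±1}` (type `I₀*`, `U_w` nilpotent); on
`Dic₁₂` rows an order-4 element of `SL₂` survives every odd-degree extension and full taming forces even degree at every `v ∣ 3`,
hence `[F:ℚ]` even, hence a DEFINITE algebra: parity lock (B-g11-1).  B-g7-3's «odd local degree ⇒ type stays supercuspidal» is
therefore false exactly on the `C₃` rows.

CHAIN on `Φ = C₃` rows (leaves, tags):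
* K_L1 [IDEA-NEEDED, technical]: SIGNED Λ-integral Heegner Kolyvagin system for `E_L` over the `K`-line of the anticyclotomic
  tower of `KL` (raw corestricted classes have growth order 3/2, B-g11-5); signed theory over a base with `e(L_w/ℚ₃) = 3 = p` is not
  in print (Kobayashi 2003, B.D. Kim, Longo–Vigni ±-Heegner, Castella–Wan arXiv:1607.02019, Büyükboduk–Lei: `p` unramified).
* K_L2 [ATTACKABLE]: Λ-adic reciprocity `𝓛og(𝐳_{KL})² ≐ 𝓛_W(E_L/KL)|_line` from finite-order `p`-adic Waldspurger over the totally
  real `L` — Liu–Zhang–Zhang 2018 [arXiv:1511.08172 p.3 L40–45: no Heegner condition, no control of ramification; only 𝔭 split] —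
  plus the torsion identity principle T of the g10 node (order 0 after signing).
* K_L3 [UNDECIDED]: Howard / Mazur–Rubin bound over `KL`; every prime of `KL` above 3 is GOOD for `E_L` (standard signed local
  conditions; the `JacquetVanishingNoLocalLine` obstruction is not met upstairs).
* D [ATTACKABLE]: `cores ∘ res = 3` ⇒ `Ch(X_K) ∣ 3ᵇ·Ch(X_{KL})|_line` — powers of 3 only, absorbed by the RATIONAL wall.
  Output of K_L ∧ D:  `F_K ∣ 3ᵃ·L_E·G_L` in `R₀⟦T⟧`, `G_L := 𝓛_W(E_L/KL)|_line / L_E` = the anticyclotomic 3-adic `L`-function of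
  `E ⊗ ρ_L` over `K` (`ρ_L = Ind_{M₀} χ₃`, the even `S₃` representation; complex avatar `L(f_{M₀} × θ_ν, ½)`, `ν = (χ∘N)(ψ∘N)` a
  NON-anticyclotomic character of the quartic CM field `KM₀`, self-dual via `ν⁻¹ = ν^{cσ}`; torsion values `G_L(ψ) = e·c_ψ²`,
  `c_ψ` = index of `cores_{KL/K}(P^{KL}_ψ)` against `y_ψ`).
* C-int [UNDECIDED · sibling]: `3^{a'}·G_L ∈ R₀⟦T⟧` ⟸ Eisenstein inclusion for `E/K` (g0-P1 / SOED) ∧ D ∧ K_L.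
* C-cop = THE RESIDUAL [IDEA-NEEDED · BARRIER-adjacent]: `(F_K, G_L) ∋ 3ᶜ` for SOME admissible `L` (3-power Bézout coprimality ⟺
  no common disc root).  B-g7-1/B-g37-1: torsion values never locate roots; B-g64-1 + B-g11-6: `G_L` is never a unit when
  `λ(L_E) > 0`, so coprimality must be genuine zero-avoidance among the infinitely many admissible `L` (fixed `L ⊗ ℚ₃`, varying tame
  ramification).  No tool in print; handles considered and found wanting: unit-ness via one value (lemma U below — moot by B-g64-1),
  Mazur–Rubin Diophantine stability (kills algebraic excess rank, not the analytic factor), horizontal mod-3 rigidity à la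
  Hida / Burungale–Tian (no common ambient Shimura variety as `L` varies; the values are Bianchi toric periods over
  `K′ = ℚ(√(d_K d_{M₀}))`, not Gross points over `M₀`).  Next-generation question Q-g11-1: a zero-repulsion statement for the family
  `{G_L}_L` at a fixed non-torsion disc point.

## Pieces of this file and their tags
* `TamableByCubic` — census-decidable row predicate [INSTRUMENTABLE; ask I-g11-2: sizes of the `C₃/C₆/Dic₁₂` split of the O6
  twin-bearing rows; all 1558 SCr rows are `Dic₁₂`].
* `WallOnCubicTamableRows`, `WallOffCubicTamableRows` — the crux restricted on/off the tamable rows [WEAKER-by-restriction;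
  evidence `wallOn_of_wall`, `wallOff_of_wall`; jointly EQUIV: `rationalSplitIMCInclusionAtThree_of_rows`].  Off-rows: BARRIER for
  this lever (B-g11-1), stays with g10 / LEAD.
* `CubicDescentCoprimeExcessAtThree` — the door [UNDECIDED as a Prop; EQUIV-as-Prop with `WallOnCubicTamableRows` (costume check
  `coprimeExcess_of_wallOn`, `G := 1`); CONTENT = producer K_L ∧ D (first conjunct) ∧ C-cop (second conjunct), tags above].
* `CubicDescentUnitExcessAtThree` — the unit-excess variant [UNDECIDED as a Prop; its producer is BARRIER-blocked off the
  `λ(L_E) = 0` locus by B-g64-1/B-g11-6; kept as the recorded dead sub-door; implies the coprime door: `coprimeExcess_of_unitExcess`].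
* `isUnit_of_hasValueAt_norm_one` — PROVED: one norm-one value in the open disc makes an element of `R₀⟦T⟧` a unit (so «unit
  excess» ⟺ «one unit torsion value», which B-g64-1 forbids when `λ(L_E) > 0`).
* `wallOn_of_coprimeExcess`, `rationalSplitIMCInclusionAtThree_of_coprimeExcess` — PROVED compositions concluding the crux BY NAME
  from (coprime-excess door on tamable rows) ∧ (wall off tamable rows).

## Disproof used
No `Disproof.lean` / `Negative/` on file for this crux (`ledger crux ls`); negatives index {stmt-15532 `LeadingTermTamePinch`, stmt-24881
`not_EquivariantChebotarevAtTwo`} disjoint from every piece.  Barriers: `TraceZeroHeegnerTowerAtAdditiveSplitP` (evaded by changing the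
base to `L`; nothing is claimed about `E/K`'s own tower — g10 `traceZero_forces_order_one` respected); `NoAdmissiblePrimesAtThree` (no level
raising); B-g10-1 (bites on raw corestricted classes, order 3/2 — leaf K_L1); B-g10-2 (no families, no BF/diagonal classes); B-g7-1 and
B-g64-1 (bite on the residual C-cop as recorded).

## Instrument asks (kit 0): I-g11-1 reduction type of three SCu `v₃(Δ) ≡ 0 (4)` rows over a cubic field with 3-adic completion the
Kraus cubic (expect I₀, `a_w ∈ {0,±3}`); I-g11-2 census split; I-g11-3 `c_ψ` for `ψ = 1` on one row and two small admissible `L`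
(3-descent over `KL` vs `K`).  Carried: acq-14979, F-g8-1, A-g9-1, E-g9-1, D-g7-1/2/3, D-g55-1, Q-BD-1/2, Q-CYC-1.

## WHY NOVEL (problem-relative, one sentence): the lineage had touched cubic/solvable base change three times (g50, g63-L7, g64-B)
and dismissed it; gen 11 turns it into a typed Kato-direction door on the exact rows where it has teeth (`Φ = C₃`, by a Mackey/CFT
computation that corrects B-g7-3), proves that unit-ness of the excess is structurally impossible for ANY taming field (`3 ∣ [F:ℚ]`
⇒ principal block, B-g11-6), and isolates the one residual no barrier on file decides: 3-power Bézout coprimality of `Ch(X_K)` with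
the anticyclotomic 3-adic `L`-function of an even-`S₃` Artin twist.
-/

set_option linter.dupNamespace false

open scoped Classical

namespace Summit.BirchSwinnertonDyer.BirchSwinnertonDyer.Cruxes.RationalSplitIMCInclusionAtThree.CubicTamingDescent

open PowerSeries Literature.NumberTheory.EllipticCurves Summit.BirchSwinnertonDyer.Rank1Residual.X11b
open Summit.BirchSwinnertonDyer.Rank1Residual.Additive

/-! ## §1 The row predicate -/

/-- **`Φ = C₃` rows (Kraus, `p = 3`)** [INSTRUMENTABLE · census-decidable]: inside class O6 (wild cell (w) at 3)
the inertia image is cyclic of order 3 iff `v₃(Δ_min) ≡ 0 (mod 4)` (Kodaira II or II*, `v₃(N) = 4`).  Exactly the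
rows on which a NON-GALOIS CUBIC base field tames the local type to good supersingular reduction (header).
[cite: Kraus1990, Théorème (p = 3)] [cite: Coppola2020, Thm. 2.7] -/
def TamableByCubic (W : WeierstrassCurve ℚ) [W.IsElliptic] [W.IsGloballyMinimal] : Prop :=
  padicValInt 3 W.minimalDiscriminantInt % 4 = 0

/-- Sanity: a tamable O6 row lies in the tree's cyclic-inertia sub-cell `SubWCyclic` (`Φ ∈ {C₃, C₆}`). -/
theorem subWCyclic_of_tamableByCubic (W : WeierstrassCurve ℚ) [W.IsElliptic] [W.IsGloballyMinimal]
    (hO6 : ClassO6 W 3) (h : TamableByCubic W) : SubWCyclic W := by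
  refine ⟨hO6.2.2, ?_⟩
  rw [Nat.even_iff]
  unfold TamableByCubic at h
  omega

/-! ## §2 The crux split along the row predicate -/

/-- **The wall ON the tamable rows** [WEAKER-by-restriction · target of this node's door]. Verbatim crux binders with
`TamableByCubic W` inserted. -/
def WallOnCubicTamableRows : Prop :=
  ∀ (W : WeierstrassCurve ℚ) [W.IsElliptic] [W.IsGloballyMinimal] (N : ℕ) [NeZero N] (K : Type) [Field K] [NumberField K] (Dt : Literature.NumberTheory.EllipticCurves.ModularForms.ModularParametrizationData W N), Summit.BirchSwinnertonDyer.Rank1Residual.Additive.ClassO6 W 3 → TamableByCubic W → W.HasSurjectiveModNGaloisRep 3 → W.analyticRank = 1 → W.conductorNorm ℤ = N → Literature.NumberTheory.EllipticCurves.IsImaginaryQuadratic K → Literature.NumberTheory.EllipticCurves.SatisfiesHeegnerHypothesis N K → ∀ (κ : Literature.NumberTheory.EllipticCurves.ZpExtension K 3), κ.IsAnticyclotomic → ∀ (γ : Field.absoluteGaloisGroup K) [Fact (κ.IsTopGenerator γ)] (𝔭 : IsDedekindDomain.HeightOneSpectrum (NumberField.RingOfIntegers K)), ((3 : ℕ)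 : NumberField.RingOfIntegers K) ∈ 𝔭.asIdeal → 𝔭.asIdeal.ramificationIdx (NumberField.RingOfIntegers ℚ) = 1 → 𝔭.asIdeal.inertiaDeg (NumberField.RingOfIntegers ℚ) = 1 → ∀ (𝔭' : IsDedekindDomain.HeightOneSpectrum (NumberField.RingOfIntegers K)), ((3 : ℕ) : NumberField.RingOfIntegers K) ∈ 𝔭'.asIdeal → 𝔭' ≠ 𝔭 → ∀ (ι' : PadicAlgCl 3 ≃+* ℂ), Summit.BirchSwinnertonDyer.BirchSwinnertonDyer.Theorems.SchneiderFree.BranchInducesPrime 3 ι' 𝔭 → ∀ (ΩK : ℂ) (Ωp : ℂ_[3]) (L : Literature.NumberTheory.EllipticCurves.UnrSeries 3), ΩK ≠ 0 → Ωp ≠ 0 → Literature.NumberTheory.EllipticCurves.IsBDPLFunction ι' 𝔭 κ γ Dt.f ΩK Ωp L →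
    ∃ k : ℕ, ((3 : ℕ) : Literature.NumberTheory.EllipticCurves.UnrSeries 3) ^ k * L ∈ (Summit.BirchSwinnertonDyer.Rank1Residual.X11b.AcSelmer.XAc.charIdeal (W.baseChange K) 3 κ 𝔭' ∅ γ).map (PowerSeries.map (Summit.BirchSwinnertonDyer.Rank1Residual.X11b.Halves.toUnr 3))

/-- **The wall OFF the tamable rows** (`Φ ∈ {C₆, Dic₁₂}`) [WEAKER-by-restriction · BARRIER for this lever: the
parity lock of B-g11-1 is genuine there; stays with the g10 / LEAD lines]. -/
def WallOffCubicTamableRows : Prop :=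
  ∀ (W : WeierstrassCurve ℚ) [W.IsElliptic] [W.IsGloballyMinimal] (N : ℕ) [NeZero N] (K : Type) [Field K] [NumberField K] (Dt : Literature.NumberTheory.EllipticCurves.ModularForms.ModularParametrizationData W N), Summit.BirchSwinnertonDyer.Rank1Residual.Additive.ClassO6 W 3 → ¬ TamableByCubic W → W.HasSurjectiveModNGaloisRep 3 → W.analyticRank = 1 → W.conductorNorm ℤ = N → Literature.NumberTheory.EllipticCurves.IsImaginaryQuadratic K → Literature.NumberTheory.EllipticCurves.SatisfiesHeegnerHypothesis N K → ∀ (κ : Literature.NumberTheory.EllipticCurves.ZpExtension K 3), κ.IsAnticyclotomic → ∀ (γ : Field.absoluteGaloisGroup K) [Fact (κ.IsTopGenerator γ)] (𝔭 : IsDedekindDomain.HeightOneSpectrum (NumberField.RingOfIntegers K)), ((3 : ℕ) : NumberField.RingOfIntegers K) ∈ 𝔭.asIdeal → 𝔭.asIdeal.ramificationIdx (NumberField.RingOfIntegers ℚ) = 1 → 𝔭.asIdeal.inertiaDeg (NumberField.RingOfIntegers ℚ) = 1 → ∀ (𝔭' : IsDedekindDomain.HeightOneSpectrum (NumberField.RingOfIntegers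 K)), ((3 : ℕ) : NumberField.RingOfIntegers K) ∈ 𝔭'.asIdeal → 𝔭' ≠ 𝔭 → ∀ (ι' : PadicAlgCl 3 ≃+* ℂ), Summit.BirchSwinnertonDyer.BirchSwinnertonDyer.Theorems.SchneiderFree.BranchInducesPrime 3 ι' 𝔭 → ∀ (ΩK : ℂ) (Ωp : ℂ_[3]) (L : Literature.NumberTheory.EllipticCurves.UnrSeries 3), ΩK ≠ 0 → Ωp ≠ 0 → Literature.NumberTheory.EllipticCurves.IsBDPLFunction ι' 𝔭 κ γ Dt.f ΩK Ωp L →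
    ∃ k : ℕ, ((3 : ℕ) : Literature.NumberTheory.EllipticCurves.UnrSeries 3) ^ k * L ∈ (Summit.BirchSwinnertonDyer.Rank1Residual.X11b.AcSelmer.XAc.charIdeal (W.baseChange K) 3 κ 𝔭' ∅ γ).map (PowerSeries.map (Summit.BirchSwinnertonDyer.Rank1Residual.X11b.Halves.toUnr 3))

/-- **On ∧ Off ⟹ 24207 (kernel, BY NAME)**: the row split is exhaustive (`by_cases` on the decidable census predicate). -/
theorem rationalSplitIMCInclusionAtThree_of_rows (hOn : WallOnCubicTamableRows) (hOff : WallOffCubicTamableRows) :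
    Summit.BirchSwinnertonDyer.BirchSwinnertonDyer.Theses.UniversalToricDescent.RationalSplitIMCInclusionAtThree := by
  intro W _ _ N _ K _ _ Dt hO6 hsurj hr1 hN hK hH κ hκ γ _ 𝔭 h𝔭 he hf 𝔭' h𝔭' hne ι' hι ΩK Ωp L hΩK hΩp hL
  by_cases htam : TamableByCubic W
  · exact hOn W N K Dt hO6 htam hsurj hr1 hN hK hH κ hκ γ 𝔭 h𝔭 he hf 𝔭' h𝔭' hne ι' hι ΩK Ωp L hΩK hΩp hL
  · exact hOff W N K Dt hO6 htam hsurj hr1 hN hK hH κ hκ γ 𝔭 h𝔭 he hf 𝔭' h𝔭' hne ι' hι ΩK Ωp L hΩK hΩp hL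

/-- Evidence for the WEAKER tag: the wall gives its restriction to the tamable rows. -/
theorem wallOn_of_wall
    (h : Summit.BirchSwinnertonDyer.BirchSwinnertonDyer.Theses.UniversalToricDescent.RationalSplitIMCInclusionAtThree) :
    WallOnCubicTamableRows := by
  intro W _ _ N _ K _ _ Dt hO6 _ hsurj hr1 hN hK hH κ hκ γ _ 𝔭 h𝔭 he hf 𝔭' h𝔭' hne ι' hι ΩK Ωp L hΩK hΩp hL
  exact h W N K Dt hO6 hsurj hr1 hN hK hH κ hκ γ 𝔭 h𝔭 he hf 𝔭' h𝔭' hne ι' hι ΩK Ωp L hΩK hΩp hL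

/-- Evidence for the WEAKER tag: the wall gives its restriction off the tamable rows. -/
theorem wallOff_of_wall
    (h : Summit.BirchSwinnertonDyer.BirchSwinnertonDyer.Theses.UniversalToricDescent.RationalSplitIMCInclusionAtThree) :
    WallOffCubicTamableRows := by
  intro W _ _ N _ K _ _ Dt hO6 _ hsurj hr1 hN hK hH κ hκ γ _ 𝔭 h𝔭 he hf 𝔭' h𝔭' hne ι' hι ΩK Ωp L hΩK hΩp hL
  exact h W N K Dt hO6 hsurj hr1 hN hK hH κ hκ γ 𝔭 h𝔭 he hf 𝔭' h𝔭' hne ι' hι ΩK Ωp L hΩK hΩp hL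

/-! ## §3 Side lemma: ONE norm-one value makes an element of `R₀⟦T⟧` a unit (why «unit excess» = «one unit torsion value»; moot by B-g64-1 / B-g11-6 off the `λ = 0` locus) -/

/-- **U (PROVED)** — an element `G ∈ R₀⟦T⟧` having ONE value of `3`-adic norm `1` at a point of the open unit disc is a
UNIT of `R₀⟦T⟧`.  (Ultrametric: `G(x) = g₀ + x·(…)` with `‖x·(…)‖ ≤ ‖x‖ < 1`, so `‖g₀‖ = ‖G(x)‖ = 1`, and the units
of `R₀` are its norm-one elements.)  Role: records WHY the unit-excess sub-door `CubicDescentUnitExcessAtThree` asks for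
exactly one norm-one value — and hence why B-g64-1 (principal-block congruence ⇒ `λ(G_L) ≥ λ(L_E) > 0` off the Nakayama locus)
closes that sub-door: an `R₀⟦T⟧`-element with positive `λ` has NO norm-one value in the open disc. -/
theorem isUnit_of_hasValueAt_norm_one {G : UnrSeries 3} {x v : ℂ_[3]} (hx : ‖x‖ < 1)
    (hG : G.HasValueAt x v) (hv : ‖v‖ = 1) : IsUnit G := by
  rw [PowerSeries.isUnit_iff_constantCoeff, unrIntegers.isUnit_iff_norm_eq_one]
  set f : ℕ → ℂ_[3] := fun k ↦ ((PowerSeries.coeff k G : unrIntegers 3) : ℂ_[3]) * x ^ k with hf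
  have hsum : HasSum f v := hG
  have hf0 : f 0 = ((PowerSeries.constantCoeff G : unrIntegers 3) : ℂ_[3]) := by
    simp [hf]
  have htail_le : ∀ k, ‖f (k + 1)‖ ≤ ‖x‖ := fun k ↦ by
    have hc : ‖((PowerSeries.coeff (k + 1) G : unrIntegers 3) : ℂ_[3])‖ ≤ 1 :=
      Halves.norm_le_one_of_mem_unrIntegers 3 (PowerSeries.coeff (k + 1) G).2
    calc ‖f (k + 1)‖ = ‖((PowerSeries.coeff (k + 1) G : unrIntegers 3) : ℂ_[3])‖ * ‖x‖ ^ (k + 1) := by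
          simp only [hf, norm_mul, norm_pow]
      _ ≤ 1 * ‖x‖ ^ (k + 1) := by gcongr
      _ ≤ ‖x‖ := by
          rw [one_mul, pow_succ]
          exact mul_le_of_le_one_left (norm_nonneg _) (pow_le_one₀ (norm_nonneg _) hx.le)
  have htail : ‖∑' k, f (k + 1)‖ ≤ ‖x‖ :=
    IsUltrametricDist.norm_tsum_le_of_forall_le_of_nonneg (norm_nonneg x) htail_le
  have hsplit : v = f 0 + ∑' k, f (k + 1) := by
    rw [← hsum.tsum_eq]
    exact hsum.summable.tsum_eq_zero_add
  have hle : ‖f 0‖ ≤ 1 := by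
    rw [hf0]
    exact Halves.norm_le_one_of_mem_unrIntegers 3 (PowerSeries.constantCoeff G).2
  have hge : 1 ≤ ‖f 0‖ := by
    have h1 : ‖f 0 + ∑' k, f (k + 1)‖ ≤ max ‖f 0‖ ‖∑' k, f (k + 1)‖ :=
      IsUltrametricDist.norm_add_le_max _ _
    rw [← hsplit, hv] at h1
    rcases le_max_iff.mp h1 with h | h
    · exact h
    · exact absurd (h.trans htail) (not_le.mpr hx)
  rw [← hf0]
  exact le_antisymm hle hge

/-! ## §4 The doors on the tamable rows and the compositions -/

/-- **S_cop [UNDECIDED · door for the `Φ = C₃` rows · EQUIV-as-Prop with `WallOnCubicTamableRows` (costume check `coprimeExcess_of_wallOn`)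
· producer = K_L1 (IDEA-NEEDED) ∧ K_L2 (ATTACKABLE) ∧ K_L3 (UNDECIDED) ∧ D (ATTACKABLE) for the first conjunct, C-int (sibling) for the
integrality of `G`, C-cop (IDEA-NEEDED; B-g7-1, B-g64-1, B-g11-6 adjacent) for the second]** CUBIC DESCENT WITH COPRIME EXCESS: on the wall's
binders for a tamable row, with `X_(∅,0)` torsion and `Ch_Λ(X)·R₀⟦T⟧ = (F)`, there are exponents `a c`, an EXCESS FACTOR `G ∈ R₀⟦T⟧` with
`3ᵃ·L·G ∈ (F)` (Kato over the cubic-tamed `KL` + descent), and a 3-power Bézout relation `r·F + s·G = 3ᶜ` (no common disc root). -/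
def CubicDescentCoprimeExcessAtThree : Prop :=
  ∀ (W : WeierstrassCurve ℚ) [W.IsElliptic] [W.IsGloballyMinimal] (N : ℕ) [NeZero N] (K : Type) [Field K] [NumberField K] (Dt : Literature.NumberTheory.EllipticCurves.ModularForms.ModularParametrizationData W N), Summit.BirchSwinnertonDyer.Rank1Residual.Additive.ClassO6 W 3 → TamableByCubic W → W.HasSurjectiveModNGaloisRep 3 → W.analyticRank = 1 → W.conductorNorm ℤ = N → Literature.NumberTheory.EllipticCurves.IsImaginaryQuadratic K → Literature.NumberTheory.EllipticCurves.SatisfiesHeegnerHypothesis N K → ∀ (κ : Literature.NumberTheory.EllipticCurves.ZpExtension K 3), κ.IsAnticyclotomic → ∀ (γ : Field.absoluteGaloisGroup K) [Fact (κ.IsTopGenerator γ)] (𝔭 : IsDedekindDomain.HeightOneSpectrum (NumberField.RingOfIntegers K)), ((3 : ℕ) : NumberField.RingOfIntegers K) ∈ 𝔭.asIdeal → 𝔭.asIdeal.ramificationIdx (NumberField.RingOfIntegers ℚ) = 1 → 𝔭.asIdeal.inertiaDeg (NumberField.RingOfIntegers ℚ) = 1 → ∀ (𝔭' : IsDedekindDomain.HeightOneSpectrum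 (NumberField.RingOfIntegers K)), ((3 : ℕ) : NumberField.RingOfIntegers K) ∈ 𝔭'.asIdeal → 𝔭' ≠ 𝔭 → ∀ (ι' : PadicAlgCl 3 ≃+* ℂ), Summit.BirchSwinnertonDyer.BirchSwinnertonDyer.Theorems.SchneiderFree.BranchInducesPrime 3 ι' 𝔭 → ∀ (ΩK : ℂ) (Ωp : ℂ_[3]) (L : Literature.NumberTheory.EllipticCurves.UnrSeries 3), ΩK ≠ 0 → Ωp ≠ 0 → Literature.NumberTheory.EllipticCurves.IsBDPLFunction ι' 𝔭 κ γ Dt.f ΩK Ωp L → Module.IsTorsion (Literature.NumberTheory.EllipticCurves.IwasawaAlgebra 3) (Summit.BirchSwinnertonDyer.Rank1Residual.X11b.AcSelmer.XAc (W.baseChange K) 3 κ 𝔭' ∅ γ) → ∀ F : Literature.NumberTheory.EllipticCurves.UnrSeries 3, (Summit.BirchSwinnertonDyer.Rank1Residual.X11b.AcSelmer.XAc.charIdeal (W.baseChange K) 3 κ 𝔭' ∅ γ).map (PowerSeries.map (Summit.BirchSwinnertonDyer.Rank1Residual.X11b.Halves.toUnr 3)) = Ideal.span {F} →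
    ∃ (a c : ℕ) (G r s : Literature.NumberTheory.EllipticCurves.UnrSeries 3),
      ((3 : ℕ) : Literature.NumberTheory.EllipticCurves.UnrSeries 3) ^ a * L * G ∈ Ideal.span {F} ∧
        r * F + s * G = ((3 : ℕ) : Literature.NumberTheory.EllipticCurves.UnrSeries 3) ^ c

/-- **S_unit [UNDECIDED as a Prop · recorded DEAD sub-door: its producer needs one UNIT torsion value of the excess factor, which
B-g64-1 / B-g11-6 forbid whenever `λ(L_E) > 0`; on the `λ(L_E) = 0` locus the row is Nakayama-anchor territory]**: as S_cop but with
ONE value of `G` of norm 1 at a point of the open disc instead of the Bézout relation. -/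
def CubicDescentUnitExcessAtThree : Prop :=
  ∀ (W : WeierstrassCurve ℚ) [W.IsElliptic] [W.IsGloballyMinimal] (N : ℕ) [NeZero N] (K : Type) [Field K] [NumberField K] (Dt : Literature.NumberTheory.EllipticCurves.ModularForms.ModularParametrizationData W N), Summit.BirchSwinnertonDyer.Rank1Residual.Additive.ClassO6 W 3 → TamableByCubic W → W.HasSurjectiveModNGaloisRep 3 → W.analyticRank = 1 → W.conductorNorm ℤ = N → Literature.NumberTheory.EllipticCurves.IsImaginaryQuadratic K → Literature.NumberTheory.EllipticCurves.SatisfiesHeegnerHypothesis N K → ∀ (κ : Literature.NumberTheory.EllipticCurves.ZpExtension K 3), κ.IsAnticyclotomic → ∀ (γ : Field.absoluteGaloisGroup K) [Fact (κ.IsTopGenerator γ)] (𝔭 : IsDedekindDomain.HeightOneSpectrum (NumberField.RingOfIntegers K)), ((3 : ℕ) : NumberField.RingOfIntegers K) ∈ 𝔭.asIdeal → 𝔭.asIdeal.ramificationIdx (NumberField.RingOfIntegers ℚ) = 1 → 𝔭.asIdeal.inertiaDeg (NumberField.RingOfIntegers ℚ) = 1 → ∀ (𝔭' : IsDedekindDomain.HeightOneSpectrum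 (NumberField.RingOfIntegers K)), ((3 : ℕ) : NumberField.RingOfIntegers K) ∈ 𝔭'.asIdeal → 𝔭' ≠ 𝔭 → ∀ (ι' : PadicAlgCl 3 ≃+* ℂ), Summit.BirchSwinnertonDyer.BirchSwinnertonDyer.Theorems.SchneiderFree.BranchInducesPrime 3 ι' 𝔭 → ∀ (ΩK : ℂ) (Ωp : ℂ_[3]) (L : Literature.NumberTheory.EllipticCurves.UnrSeries 3), ΩK ≠ 0 → Ωp ≠ 0 → Literature.NumberTheory.EllipticCurves.IsBDPLFunction ι' 𝔭 κ γ Dt.f ΩK Ωp L → Module.IsTorsion (Literature.NumberTheory.EllipticCurves.IwasawaAlgebra 3) (Summit.BirchSwinnertonDyer.Rank1Residual.X11b.AcSelmer.XAc (W.baseChange K) 3 κ 𝔭' ∅ γ) → ∀ F : Literature.NumberTheory.EllipticCurves.UnrSeries 3, (Summit.BirchSwinnertonDyer.Rank1Residual.X11b.AcSelmer.XAc.charIdeal (W.baseChange K) 3 κ 𝔭' ∅ γ).map (PowerSeries.map (Summit.BirchSwinnertonDyer.Rank1Residual.X11b.Halves.toUnr 3)) = Ideal.span {F} →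
    ∃ (a : ℕ) (G : Literature.NumberTheory.EllipticCurves.UnrSeries 3) (x v : ℂ_[3]),
      ((3 : ℕ) : Literature.NumberTheory.EllipticCurves.UnrSeries 3) ^ a * L * G ∈ Ideal.span {F} ∧ ‖x‖ < 1 ∧ G.HasValueAt x v ∧ ‖v‖ = 1

/-- The extended characteristic ideal is principal: `Ch_Λ(X)·R₀⟦T⟧ = (F)` (gen-3…10 currency, verbatim). -/
theorem exists_map_charIdeal_eq_span {K : Type} [Field K] [NumberField K] (W : WeierstrassCurve K)
    (κ : ZpExtension K 3) (𝔭' : IsDedekindDomain.HeightOneSpectrum (NumberField.RingOfIntegers K))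
    (γ : Field.absoluteGaloisGroup K) [Fact (κ.IsTopGenerator γ)] :
    ∃ F : UnrSeries 3, (AcSelmer.XAc.charIdeal W 3 κ 𝔭' ∅ γ).map (PowerSeries.map (Halves.toUnr 3)) =
      Ideal.span {F} := by
  obtain ⟨f, hf⟩ := (charIdeal_isPrincipal_holds 3 (AcSelmer.XAc W 3 κ 𝔭' ∅ γ)).principal
  refine ⟨PowerSeries.map (Halves.toUnr 3) f, ?_⟩
  have hf' : AcSelmer.XAc.charIdeal W 3 κ 𝔭' ∅ γ = Ideal.span {f} := by
    change Literature.NumberTheory.EllipticCurves.Module.charIdeal (IwasawaAlgebra 3) (AcSelmer.XAc W 3 κ 𝔭' ∅ γ) =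
      Ideal.span {f}
    simpa [Ideal.submodule_span_eq] using hf
  rw [hf', Ideal.map_span, Set.image_singleton]

/-- **S_unit ⟹ S_cop (kernel):** a unit excess factor is coprime to everything (`r := 0`, `s := G⁻¹`, `c := 0`). -/
theorem coprimeExcess_of_unitExcess (hS : CubicDescentUnitExcessAtThree) : CubicDescentCoprimeExcessAtThree := by
  intro W _ _ N _ K _ _ Dt hO6 htam hsurj hr1 hN hK hH κ hκ γ _ 𝔭 h𝔭 he hf 𝔭' h𝔭' hne ι' hι ΩK Ωp L hΩK hΩp hL htor F hF
  obtain ⟨a, G, x, v, hG, hx, hGx, hv⟩ := hS W N K Dt hO6 htam hsurj hr1 hN hK hH κ hκ γ 𝔭 h𝔭 he hf 𝔭' h𝔭' hne ι' hι ΩK Ωp L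
    hΩK hΩp hL htor F hF
  obtain ⟨u, hu⟩ := isUnit_of_hasValueAt_norm_one hx hGx hv
  refine ⟨a, 0, G, 0, ((u⁻¹ : (UnrSeries 3)ˣ) : UnrSeries 3), hG, ?_⟩
  rw [zero_mul, zero_add, pow_zero, ← hu, Units.inv_mul]

/-- **S_cop ⟹ wall on the tamable rows (kernel).**  Non-torsion `X`: `Ch = ⊤`, `k = 0`.  Torsion: `Ch·R₀⟦T⟧ = (F)`; S_cop gives
`3ᵃ·L·G ∈ (F)` and `r·F + s·G = 3ᶜ`; then `3^{a+c}·L = (3ᵃ·L·r)·F + s·(3ᵃ·L·G) ∈ (F)`. -/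
theorem wallOn_of_coprimeExcess (hS : CubicDescentCoprimeExcessAtThree) : WallOnCubicTamableRows := by
  intro W _ _ N _ K _ _ Dt hO6 htam hsurj hr1 hN hK hH κ hκ γ _ 𝔭 h𝔭 he hf 𝔭' h𝔭' hne ι' hι ΩK Ωp L hΩK hΩp hL
  by_cases htor : Module.IsTorsion (IwasawaAlgebra 3) (AcSelmer.XAc (W.baseChange K) 3 κ 𝔭' ∅ γ)
  · obtain ⟨F, hF⟩ := exists_map_charIdeal_eq_span (W.baseChange K) κ 𝔭' γ
    obtain ⟨a, c, G, r, s, hG, hbez⟩ := hS W N K Dt hO6 htam hsurj hr1 hN hK hH κ hκ γ 𝔭 h𝔭 he hf 𝔭' h𝔭' hne ι' hι ΩK Ωp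
      L hΩK hΩp hL htor F hF
    refine ⟨a + c, ?_⟩
    have key : ((3 : ℕ) : UnrSeries 3) ^ (a + c) * L =
        (((3 : ℕ) : UnrSeries 3) ^ a * L * r) * F + s * (((3 : ℕ) : UnrSeries 3) ^ a * L * G) := by
      rw [pow_add]
      have : ((3 : ℕ) : UnrSeries 3) ^ a * ((3 : ℕ) : UnrSeries 3) ^ c * L =
          ((3 : ℕ) : UnrSeries 3) ^ a * L * (r * F + s * G) := by rw [hbez]; ring
      rw [this]; ring
    rw [hF, key]
    exact Ideal.add_mem _ (Ideal.mul_mem_left _ _ (Ideal.mem_span_singleton_self F)) (Ideal.mul_mem_left _ _ hG)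
  · refine ⟨0, ?_⟩
    have htop : AcSelmer.XAc.charIdeal (W.baseChange K) 3 κ 𝔭' ∅ γ = ⊤ :=
      Summit.BirchSwinnertonDyer.BirchSwinnertonDyer.Theorems.charIdeal_eq_top_of_not_isTorsion (p := 3) _ htor
    rw [htop, Ideal.map_top]; exact Submodule.mem_top

/-- **S_cop ∧ Off ⟹ 24207 (kernel, BY NAME).** -/
theorem rationalSplitIMCInclusionAtThree_of_coprimeExcess
    (hS : CubicDescentCoprimeExcessAtThree) (hOff : WallOffCubicTamableRows) :
    Summit.BirchSwinnertonDyer.BirchSwinnertonDyer.Theses.UniversalToricDescent.RationalSplitIMCInclusionAtThree :=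
  rationalSplitIMCInclusionAtThree_of_rows (wallOn_of_coprimeExcess hS) hOff

/-- **S_unit ∧ Off ⟹ 24207 (kernel, BY NAME)** — via `coprimeExcess_of_unitExcess`. -/
theorem rationalSplitIMCInclusionAtThree_of_unitExcess
    (hS : CubicDescentUnitExcessAtThree) (hOff : WallOffCubicTamableRows) :
    Summit.BirchSwinnertonDyer.BirchSwinnertonDyer.Theses.UniversalToricDescent.RationalSplitIMCInclusionAtThree :=
  rationalSplitIMCInclusionAtThree_of_coprimeExcess (coprimeExcess_of_unitExcess hS) hOff

/-- **Costume check (evidence for the EQUIV-as-Prop tag of S_cop):** the wall on the tamable rows gives S_cop with `G := 1`,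
`r := 0`, `s := 1`, `c := 0`.  So S_cop carries content only through its informal producer (leaves K_L, D, C-cop). -/
theorem coprimeExcess_of_wallOn (h : WallOnCubicTamableRows) : CubicDescentCoprimeExcessAtThree := by
  intro W _ _ N _ K _ _ Dt hO6 htam hsurj hr1 hN hK hH κ hκ γ _ 𝔭 h𝔭 he hf 𝔭' h𝔭' hne ι' hι ΩK Ωp L hΩK hΩp hL _ F hF
  obtain ⟨k, hk⟩ := h W N K Dt hO6 htam hsurj hr1 hN hK hH κ hκ γ 𝔭 h𝔭 he hf 𝔭' h𝔭' hne ι' hι ΩK Ωp L hΩK hΩp hL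
  refine ⟨k, 0, 1, 0, 1, ?_, by simp⟩
  rw [mul_one, ← hF]; exact hk

/-- **Costume check for S_unit:** the wall gives S_unit with `G := 1`, `x := 0`, `v := 1`. -/
theorem unitExcess_of_wallOn (h : WallOnCubicTamableRows) : CubicDescentUnitExcessAtThree := by
  intro W _ _ N _ K _ _ Dt hO6 htam hsurj hr1 hN hK hH κ hκ γ _ 𝔭 h𝔭 he hf 𝔭' h𝔭' hne ι' hι ΩK Ωp L hΩK hΩp hL _ F hF
  obtain ⟨k, hk⟩ := h W N K Dt hO6 htam hsurj hr1 hN hK hH κ hκ γ 𝔭 h𝔭 he hf 𝔭' h𝔭' hne ι' hι ΩK Ωp L hΩK hΩp hL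
  refine ⟨k, 1, 0, 1, ?_, by simp, ?_, by simp⟩
  · rw [mul_one, ← hF]; exact hk
  · simpa using (1 : UnrSeries 3).hasValueAt_zero

end Summit.BirchSwinnertonDyer.BirchSwinnertonDyer.Cruxes.RationalSplitIMCInclusionAtThree.CubicTamingDescent
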